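import Summits.MatrixMultiplication.OmegaCensus.DominoZpZpStructSixWide
import Summits.MatrixMultiplication.OmegaCensus.DominoZpZpStructFiveGen
import HarnessLib

/-!
# Chunked checks for the structural part-`6` route (tree-form scaling closure, `*_append` lemmas, `y`-list chunking)

ω-census `pub-omega`, family (b3), seat pub-omega-group gen 25.  Framing: lottery ticket; floor = certified bounds/negative
ranges.  VALUE: the part-`6` copies of the chunking lemmas of `DominoZpZpStructSeven.lean` (gen 24): for `p = 17, 19` the
excluded list has `1104` resp. `1152` keys, and the quadratic list-form decides `checkE2g` / `checkR6` over the whole list exhaust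
the kernel (one decide must stay small), exactly as `checkR7` did at `|E| = 760`; here the closure under the primitive root is
checked through the SOUND code tree of `E` (`checkE2gt6`, linear in `|E|`), and both checks are decided per literal chunk of `E` and
assembled with `checkE2gt6_append` / `checkR6_append`; `checkH6c_appendYS` / `checkH6x_appendYS` chunk the `y`-arrangement list of a
pair check (one decide per chunk).  Aimed at the OPEN census cells `(1,6,16)@289`, `(1,6,20)@361`; NOT
progress on ω.
-/

namespace Summit.MatrixMultiplication.OmegaCensus

namespace ZpZpDomino

/-- Closure of `E` under the scaling `v ↦ g·v` checked through the SOUND code tree `et` of `E` (codes `polyBE 7`; linear in `|E|`).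
[folklore] -/
def checkE2gt6 (p g : ℕ) (E : List (List ℕ)) (et : BTree) : Bool :=
  !(g % p == 0) && (isGenB p g && E.all fun k => et.mem (polyBE 7 (scaleVec p g k)))

/-- `checkE2gt6` ⇒ `checkE2g` (tree soundness + injectivity of the codes on well-formed keys). [folklore] -/
theorem checkE2g_of_checkE2gt6 {p g : ℕ} {E : List (List ℕ)} {et : BTree} (hEwf : checkEwf6 p E = true)
    (hEt' : ∀ x, et.mem x = true → x ∈ E.map (polyBE 7)) (h : checkE2gt6 p g E et = true) : checkE2g p g E = true := by
  simp only [checkE2gt6, Bool.and_eq_true, List.all_eq_true] at h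
  obtain ⟨hg, hgen, hcl⟩ := h
  simp only [checkE2g, Bool.and_eq_true, List.all_eq_true, List.contains_iff_mem]
  refine ⟨hg, hgen, fun k hk => ?_⟩
  have hm := hEt' _ (hcl k hk)
  rw [List.mem_map] at hm
  obtain ⟨k', hk', hcode⟩ := hm
  simp only [checkEwf6, List.all_eq_true, Bool.and_eq_true, beq_iff_eq, decide_eq_true_eq] at hEwf
  obtain ⟨hlen, hdig⟩ := hEwf k hk
  obtain ⟨hlen', hdig'⟩ := hEwf k' hk'
  have hlenS : (scaleVec p g k).length = p := by simp [scaleVec]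
  have hdigS : ∀ x ∈ scaleVec p g k, x < 7 := by
    intro x hx
    simp only [scaleVec, List.mem_map, List.mem_range] at hx
    obtain ⟨w, -, rfl⟩ := hx
    rw [List.getD_eq_getElem?_getD]
    cases hq : k[invMod p g * w % p]? with
    | none => simp
    | some y => simpa using hdig y (List.mem_of_getElem? hq)
  have e : k' = scaleVec p g k := polyBE_inj (by rw [hlen', hlenS]) hdig' hdigS hcode
  exact e ▸ hk'

/-- Chunking `checkE2gt6` over the excluded list (one kernel decide must stay small). [folklore] -/
theorem checkE2gt6_append {p g : ℕ} {E₁ E₂ : List (List ℕ)} {et : BTree} (h₁ : checkE2gt6 p g E₁ et = true)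
    (h₂ : checkE2gt6 p g E₂ et = true) : checkE2gt6 p g (E₁ ++ E₂) et = true := by
  simp only [checkE2gt6, Bool.and_eq_true, List.all_append] at h₁ h₂ ⊢
  exact ⟨h₁.1, h₁.2.1, h₁.2.2, h₂.2.2⟩

/-- Chunking `checkR6` over the excluded list. [folklore] -/
theorem checkR6_append {p : ℕ} {E₁ E₂ R : List (List ℕ)} (h₁ : checkR6 p E₁ R = true) (h₂ : checkR6 p E₂ R = true) :
    checkR6 p (E₁ ++ E₂) R = true := by
  simp only [checkR6, List.all_append, Bool.and_eq_true] at h₁ h₂ ⊢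
  exact ⟨h₁, h₂⟩

/-- Chunking `checkE1six`. [folklore] -/
theorem checkE1six_append {E₁ E₂ : List (List ℕ)} (h₁ : checkE1six E₁ = true) (h₂ : checkE1six E₂ = true) :
    checkE1six (E₁ ++ E₂) = true := by
  simp only [checkE1six, List.all_append, Bool.and_eq_true] at h₁ h₂ ⊢
  exact ⟨h₁, h₂⟩

/-- Chunking `checkEwf6`. [folklore] -/
theorem checkEwf6_append {p : ℕ} {E₁ E₂ : List (List ℕ)} (h₁ : checkEwf6 p E₁ = true) (h₂ : checkEwf6 p E₂ = true) :
    checkEwf6 p (E₁ ++ E₂) = true := by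
  simp only [checkEwf6, List.all_append, Bool.and_eq_true] at h₁ h₂ ⊢
  exact ⟨h₁, h₂⟩

/-- Chunking the `y`-list of a one-`x` pair check. [folklore] -/
theorem checkH6x_appendYS {p : ℕ} {et : BTree} {YS₁ YS₂ : List (List ℕ)} {xs : List ℕ}
    (h₁ : checkH6x p et YS₁ xs = true) (h₂ : checkH6x p et YS₂ xs = true) : checkH6x p et (YS₁ ++ YS₂) xs = true := by
  simp only [checkH6x, List.all_append, Bool.and_eq_true] at h₁ h₂ ⊢
  exact ⟨h₁, h₂⟩

/-- Chunking the `y`-list of the family-`c` check of one representative. [folklore] -/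
theorem checkH6c_appendYS {p : ℕ} {et : BTree} {YS₁ YS₂ : List (List ℕ)} {k : List ℕ}
    (h₁ : checkH6c p et YS₁ k = true) (h₂ : checkH6c p et YS₂ k = true) : checkH6c p et (YS₁ ++ YS₂) k = true := by
  simp only [checkH6c, List.all_eq_true] at h₁ h₂ ⊢
  intro xs hxs ys hys
  rw [List.mem_append] at hys
  rcases hys with hys | hys
  exacts [h₁ xs hxs ys hys, h₂ xs hxs ys hys]

end ZpZpDomino

end Summit.MatrixMultiplication.OmegaCensus
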